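import Mathlib
import Summits.Ventures.PercRepro2.SwOutCube

/-!
# The generic cross-arm cube: fibre data and the cube (blind cell PercRepro2, night-4 g23,
2026-08-28; proofs/NIGHT4-G23.md §8)

The abstract theorem of boundary (iv) (`SwOutCrossThm`, two dropped vertices and one cross edge)
depends on the dropped component only through FINITE facts about its fibre: the points `W`, the
flip, the red fibre atoms of a point (`red`: the attached vertices and the red cross edges of the
cluster of `u`), the red-side leak, the core points, the label with its order, the slab injection
`psi`, and the pairing of the core points by the flip.  `FibreData` bundles them; the cube
`Config ι × W`, its atoms `ι ⊕ Unit ⊕ A`, `ER`, `EB`, the leak, the type and its order and the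
set `QX` are defined from them; `SwOutCrossGenThm` proves the inequality for every `FibreData`,
and the instances (two vertices with a cross edge, three vertices on a path, …) discharge the
finite facts by `decide`.
-/

namespace Summit.Ventures.PercRepro2

namespace CrossArm

/-- **The fibre data of a dropped component**: the finite facts the abstract theorem uses, on the
fibre points `W`, the fibre atoms `A` (the dropped vertices and the cross edges) and the labels
`L`. -/
structure FibreData (W A L : Type*) where
  /-- the flip of a fibre point -/
  flip : W → W
  /-- the flip is an involution -/
  flip_flip : ∀ w, flip (flip w) = w
  /-- the red fibre atoms of a point, when `u` is red (the attached vertices, the red cross edges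
  of the cluster of `u`) -/
  red : W → A → Bool
  /-- the red-side leak of a point (meaningful when some u-arm is red) -/
  leakR : W → Bool
  /-- the core points -/
  core : W → Bool
  /-- the label of a point -/
  label : W → L
  /-- `BetterL l' l`: `l'` is at least as good a label as `l` -/
  BetterL : L → L → Prop
  /-- `BetterL` is reflexive -/
  betterL_refl : ∀ l, BetterL l l
  /-- the slab injection -/
  psi : W → W
  /-- a point without red-side and without blue-side leak is core -/
  core_of_noLeak : ∀ w, leakR w = false → leakR (flip w) = false → core w = true
  /-- core points do not leak on the red side -/
  leakR_core : ∀ w, core w = true → leakR w = false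
  /-- core points do not leak on the blue side -/
  leakR_flip_core : ∀ w, core w = true → leakR (flip w) = false
  /-- the flip of a core point is core -/
  core_flip : ∀ w, core w = true → core (flip w) = true
  /-- the slab injection: on a non-core point without red-side leak, the image has no blue-side
  leak, is not core, has a better label, and its flip carries the red atoms of the source -/
  psi_ok : ∀ w, leakR w = false → core w = false →
    leakR (flip (psi w)) = false ∧ core (psi w) = false ∧ BetterL (label (psi w)) (label w) ∧
      ∀ a, red w a = true → red (flip (psi w)) a = true
  /-- the slab injection is injective on the non-core points without red-side leak -/
  psi_inj : ∀ w w', leakR w = false → core w = false → leakR w' = false → core w' = false →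
    psi w = psi w' → w = w'
  /-- the lower half of the core points -/
  core0 : Finset W
  /-- the lower half consists of core points -/
  core0_core : ∀ w ∈ core0, core w = true
  /-- every core point is in the lower half or the flip of one -/
  core_cases : ∀ w, core w = true → w ∈ core0 ∨ ∃ w₀ ∈ core0, w = flip w₀
  /-- the flip of a lower core point is not a lower core point -/
  flip_core0 : ∀ w ∈ core0, flip w ∉ core0
  /-- a lower core point has a better label than its flip -/
  pair_label : ∀ w ∈ core0, BetterL (label w) (label (flip w))
  /-- the red atoms of a lower core point are red atoms of its flip -/
  pair_red : ∀ w ∈ core0, ∀ a, red w a = true → red (flip w) a = true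

section Points

variable (W A L : Type*) (ι : Type*)

/-- A point of the cube: the u-arm bits and the fibre point. -/
abbrev PtG := Config ι × W

/-- The atoms: the u-arms, `u`, the fibre atoms. -/
abbrev AtomG := ι ⊕ (Unit ⊕ A)

/-- The type of a point: the u-arm bits and the label of the fibre point. -/
abbrev TypG := Config ι × L

variable {W A L ι} (F : FibreData W A L)

/-- Some u-arm is red: `u` lies in the red cluster of `h`. -/
def redUG (s : Config ι) : Prop := ∃ j, s j = true

/-- Some u-arm is blue: `u` lies in the blue cluster of `h`. -/
def blueUG (s : Config ι) : Prop := ∃ j, s j = false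

/-- The leak of a point. -/
def LeakG (q : PtG W ι) : Prop :=
  (redUG q.1 ∧ F.leakR q.2 = true) ∨ (blueUG q.1 ∧ F.leakR (F.flip q.2) = true)

/-- The red atoms of a point: the red u-arms, `u` when some u-arm is red, and then the red fibre
atoms. -/
def ERG (q : PtG W ι) : Set (AtomG A ι) := fun a =>
  match a with
  | Sum.inl j => q.1 j = true
  | Sum.inr (Sum.inl _) => redUG q.1
  | Sum.inr (Sum.inr a) => redUG q.1 ∧ F.red q.2 a = true

/-- The total flip of a point. -/
def flipG (q : PtG W ι) : PtG W ι := (flipAll q.1, F.flip q.2)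

/-- The blue atoms: the red atoms of the flip. -/
def EBG (q : PtG W ι) : Set (AtomG A ι) := ERG F (flipG F q)

/-- The type of a point. -/
def typG (q : PtG W ι) : TypG L ι := (q.1, F.label q.2)

/-- `t'` is at least as good a type as `t`: no more red u-arms, and a better label. -/
def BetterG (t' t : TypG L ι) : Prop :=
  (∀ j, t.1 j = false → t'.1 j = false) ∧ F.BetterL t'.2 t.2

/-- An up-set of types. -/
def IsUpG (𝒯 : Set (TypG L ι)) : Prop := ∀ t ∈ 𝒯, ∀ t', BetterG F t' t → t' ∈ 𝒯

section Finite

variable [Fintype ι] [DecidableEq ι] [Fintype W] [DecidableEq W]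

open scoped Classical in
/-- The non-leaking points whose type lies in `𝒯`. -/
noncomputable def QG (𝒯 : Set (TypG L ι)) : Finset (PtG W ι) :=
  Finset.univ.filter fun q => ¬ LeakG F q ∧ typG F q ∈ 𝒯

end Finite

end Points

end CrossArm

end Summit.Ventures.PercRepro2
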